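import Literature.Analysis.FunctionSpaces.HolderManifoldSchauder
import Literature.Analysis.FunctionSpaces.HolderManifoldModelIsomorphism
import Literature.Analysis.FunctionSpaces.HolderManifoldModelEllipticity
import Literature.Geometry.Riemannian.EllipticMaximumPrincipleClosed
import Literature.Geometry.Riemannian.GurskyViaclovskyLinearisation
import HarnessLib

/-!
# Stub O5 `stub_modelEstimate`: the Schauder estimate for `L₀ = Δ_g − 1` on `C^{2,α}_𝔄(M)`

Line `margerin-cone-hamilton-rails` of crux `EntropyRung.ChangGurskyYang`
(stmt-SmoothPoincare4-10834), stub O5. On a closed Riemannian `4`-manifold with Hölder chart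
data `𝔄` and `0 < α < 1`,

  `‖u‖_{C^{2,α}_𝔄} ≤ C ‖(Δ_g − 1) u‖_{C^{0,α}_𝔄}`  for all `u ∈ C^{2,α}_𝔄(M)`,

which is exactly the hypothesis `hest` of the tree's
`Literature.Analysis.FunctionSpaces.exists_modelOperator_continuousLinearEquiv_of_estimate`.
Assembly (Gilbarg–Trudinger 2001, Thm. 6.2 patched over the charts, plus the maximum principle):

* the global Schauder estimate `exists_schauder_global` of the tree, for the chart representation
  of `Δ_g − 1` (`dalembertianPieceCLM_apply_eq`: coefficients `η_j Ĝ⁻¹`, `η_j b`, `−1`, with the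
  chart cutoffs `η_j = 1` on a closed thickening of `chart_j(tsupport ρ_j)`,
  `HolderChartData.exists_cthickening_cutoff_eq_one`), whose coefficient hypotheses are: symmetry
  of `Ĝ⁻¹` (`gramInv_symm`), global bounds and Hölder constants of the smooth compactly supported
  coefficients (`exists_bound_holderWith_of_hasCompactSupport`), and uniform ellipticity of `Ĝ⁻¹`
  on the compact thickenings (`gramInv_quadratic_pos`, `exists_ellipticity_const_of_continuousOn`);
* the a priori bound `sup |u| ≤ card ι · ‖(Δ_g − 1)u‖`
  (`HolderManifoldFunction.norm_apply_le_card_mul_norm_modelOperator`, the maximum principle),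
  which removes the `sup |u|` term of the global estimate.

## References

* D. Gilbarg, N. S. Trudinger, *Elliptic Partial Differential Equations of Second Order* (2001),
  Thm. 3.7, Thm. 6.2, §6.3, Thm. 6.14. [GilbargTrudinger2001]
* M. J. Gursky, J. A. Viaclovsky, J. Differential Geom. 63 (2003) 131–154, Prop. 2 and §5.
  [GurskyViaclovsky2003]
-/

noncomputable section

set_option linter.dupNamespace false

open Set Function Filter
open scoped Manifold ContDiff Topology NNReal
open Literature.Analysis.FunctionSpaces Literature.Geometry.Riemannian
open Literature.Geometry.Lorentzian Literature.Geometry.Lorentzian.PseudoRiemannianMetric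

namespace Summit.SmoothPoincare4.SmoothPoincare4.Theorems.MargerinRails

/-- An algebraic rearrangement identifying the chart representation of `Δ_g − 1`:
`p(η(ΣΣ G D² + Σ F D + 0·r)) − p r = p(ΣΣ (ηG) D² + Σ (ηF) D + (−1) r)`. [folklore] -/
theorem modelEstimate_rep_algebra {κ : Type*} [Fintype κ] (p η r : ℝ) (G D2 : κ → κ → ℝ)
    (F D1 : κ → ℝ) :
    p * (η * ((∑ i, ∑ i', G i i' * D2 i i') + (∑ l, F l * D1 l) + 0 * r)) - p * r =
      p * ((∑ i, ∑ i', η * G i i' * D2 i i') + (∑ l, η * F l * D1 l) + (-1) * r) := by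
  have e2 : (∑ i, ∑ i', η * G i i' * D2 i i') = η * ∑ i, ∑ i', G i i' * D2 i i' := by
    rw [Finset.mul_sum]
    refine Finset.sum_congr rfl fun i _ => ?_
    rw [Finset.mul_sum]
    exact Finset.sum_congr rfl fun i' _ => by ring
  have e1 : (∑ l, η * F l * D1 l) = η * ∑ l, F l * D1 l := by
    rw [Finset.mul_sum]
    exact Finset.sum_congr rfl fun l _ => by ring
  rw [e2, e1]
  ring

/-- **STUB O5 — THE SCHAUDER ESTIMATE FOR THE MODEL OPERATOR `Δ_g − 1` on `C^{2,α}_𝔄(M)`**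
(Gilbarg–Trudinger Thm. 6.2 patched over the charts = the tree's `exists_schauder_global`,
specialised to the chart representation of `Δ_g` (`dalembertianPieceCLM_apply_eq`, coefficients
`gramInv`, `firstOrderCoeff`, smooth on the chart targets, uniformly elliptic for Riemannian `g` on
the compact thickenings), plus the a-priori bound `sup|u| ≤ sup|(Δ_g − 1)u|` of the maximum
principle and `‖f x‖ ≤ card ι · ‖f‖` (`norm_apply_le`)). This is exactly the hypothesis `hest` of
`exists_modelOperator_continuousLinearEquiv_of_estimate` (`HolderManifoldModelIsomorphism.lean`).
[cite: GilbargTrudinger2001, Thm. 6.2 and §6.3, Thm. 6.14] -/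
theorem stub_modelEstimate :
    ∀ (M : Type) [TopologicalSpace M] [T2Space M] [ChartedSpace (EuclideanSpace ℝ (Fin 4)) M]
      [IsManifold (𝓡 4) ∞ M] [CompactSpace M] {ι : Type} [Fintype ι]
      (𝔄 : HolderChartData ι (EuclideanSpace ℝ (Fin 4)) M)
      (g : PseudoRiemannianMetric (𝓡 4) ∞ (EuclideanSpace ℝ (Fin 4)) (TangentSpace (𝓡 4) : M → Type _))
      [g.HasLeviCivita], g.IsRiemannian → ∀ {α : ℝ≥0}, 0 < α → ∀ (hα1 : α < 1),
      ∃ C : ℝ, ∀ u : HolderManifoldFunction 𝔄 ℝ (0 + 2) α, ‖u‖ ≤ C * ‖modelOperatorCLM 𝔄 g hα1.le u‖ := by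
  intro M _ _ _ _ _ ι _ 𝔄 g _ hg α hα0 hα1
  -- the orthonormal frame of the model space
  set bE : OrthonormalBasis (Fin 4) ℝ (EuclideanSpace ℝ (Fin 4)) :=
    EuclideanSpace.basisFun (Fin 4) ℝ
  have h1top : ((1 : ℕ) : WithTop ℕ∞) ≤ ((⊤ : ℕ∞) : WithTop ℕ∞) := WithTop.coe_le_coe.mpr le_top
  -- Step 1: closed thickenings `K'_j` of `K_j = chart_j(tsupport ρ_j)` on which `η_j = 1`
  obtain ⟨ρ₁, hρ₁, hη1⟩ := 𝔄.exists_cthickening_cutoff_eq_one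
  set K' : ι → Set (EuclideanSpace ℝ (Fin 4)) := fun j =>
    Metric.cthickening ρ₁ (𝔄.chart j '' tsupport (𝔄.ρ j))
  have hK'c : ∀ j, IsCompact (K' j) := fun j => (𝔄.isCompact_image_tsupport j).1.cthickening
  have hK't : ∀ j, K' j ⊆ (𝔄.chart j).target := fun j y hy =>
    𝔄.mem_target_of_cutoff_ne_zero (by rw [hη1 j y hy]; exact one_ne_zero)
  have hthick : ∀ j, Metric.thickening ρ₁ (𝔄.chart j '' tsupport (𝔄.ρ j)) ⊆ K' j := fun j =>
    Metric.thickening_subset_cthickening _ _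
  -- Step 2: the ellipticity constant of `Ĝ⁻¹` on the compact sets `K'_j`
  have hl' : ∀ j, ∃ lam : ℝ, 0 < lam ∧ ∀ y ∈ K' j, ∀ ξ : Fin 4 → ℝ, lam * ∑ i, ξ i ^ 2 ≤
      ∑ i, ∑ i', gramInv bE.toBasis g (𝔄.center j) y i i' * ξ i * ξ i' := fun j =>
    exists_ellipticity_const_of_continuousOn (hK'c j)
      (fun i i' => (contDiffOn_gramInv bE.toBasis g (𝔄.center j) i i').continuousOn.mono (hK't j))
      (fun y hy ξ hξ => gramInv_quadratic_pos bE.toBasis g (𝔄.center j) hg (hK't j hy) hξ)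
  choose lam hlam0 hlam using hl'
  obtain ⟨l, hl, hlle⟩ := exists_pos_forall_le_of_finite hlam0
  -- Step 3: the coefficients `η_j Ĝ⁻¹`, `η_j b`, `−1` and their bounds
  set acoef : ι → Fin 4 → Fin 4 → EuclideanSpace ℝ (Fin 4) → ℝ := fun j i i' y =>
    𝔄.cutoff j y * gramInv bE.toBasis g (𝔄.center j) y i i' with hacoef
  set bcoef : ι → Fin 4 → EuclideanSpace ℝ (Fin 4) → ℝ := fun j l' y =>
    𝔄.cutoff j y * firstOrderCoeff bE.toBasis g (𝔄.center j) l' y with hbcoef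
  set ccoef : ι → EuclideanSpace ℝ (Fin 4) → ℝ := fun _ _ => -1 with hccoef
  have haS : ∀ j i i', ContDiff ℝ ∞ (acoef j i i') := fun j i i' =>
    ContDiffHolderFunction.contDiff_cutoff_mul (𝔄.contDiff_cutoff j) (𝔄.chart j).open_target
      (contDiffOn_gramInv bE.toBasis g (𝔄.center j) i i') (𝔄.tsupport_cutoff_subset j)
  have hbS : ∀ j l', ContDiff ℝ ∞ (bcoef j l') := fun j l' =>
    ContDiffHolderFunction.contDiff_cutoff_mul (𝔄.contDiff_cutoff j) (𝔄.chart j).open_target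
      (contDiffOn_firstOrderCoeff bE.toBasis g (𝔄.center j) l') (𝔄.tsupport_cutoff_subset j)
  choose Zs Zh hZ using fun j i i' => exists_bound_holderWith_of_hasCompactSupport
    ((haS j i i').of_le (by exact_mod_cast h1top))
    (ContDiffHolderFunction.hasCompactSupport_cutoff_mul (𝔄.hasCompactSupport_cutoff j) _) hα1.le
  choose Ws Wh hW using fun j l' => exists_bound_holderWith_of_hasCompactSupport
    ((hbS j l').of_le (by exact_mod_cast h1top))
    (ContDiffHolderFunction.hasCompactSupport_cutoff_mul (𝔄.hasCompactSupport_cutoff j) _) hα1.le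
  set Ka : ℝ≥0 := Finset.univ.sup (fun q : ι × Fin 4 × Fin 4 =>
    Zs q.1 q.2.1 q.2.2 + Zh q.1 q.2.1 q.2.2)
  set Kb : ℝ≥0 := Finset.univ.sup (fun q : ι × Fin 4 => Ws q.1 q.2 + Wh q.1 q.2)
  have hKa' : ∀ j i i', Zs j i i' ≤ Ka ∧ Zh j i i' ≤ Ka := fun j i i' => by
    have h := Finset.le_sup
      (f := fun q : ι × Fin 4 × Fin 4 => Zs q.1 q.2.1 q.2.2 + Zh q.1 q.2.1 q.2.2)
      (Finset.mem_univ (j, i, i'))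
    exact ⟨le_self_add.trans h, le_add_self.trans h⟩
  have hKb' : ∀ j l', Ws j l' ≤ Kb ∧ Wh j l' ≤ Kb := fun j l' => by
    have h := Finset.le_sup (f := fun q : ι × Fin 4 => Ws q.1 q.2 + Wh q.1 q.2)
      (Finset.mem_univ (j, l'))
    exact ⟨le_self_add.trans h, le_add_self.trans h⟩
  have ha0 : ∀ j i i' y, ‖acoef j i i' y‖ ≤ Ka := fun j i i' y =>
    ((hZ j i i').1 y).trans (NNReal.coe_le_coe.2 (hKa' j i i').1)
  -- Step 4: the global Schauder estimate with these data
  obtain ⟨C, -, hC⟩ := exists_schauder_global 𝔄 bE hα0 hα1 hl (Fintype.card (Fin 4) * Ka) Ka Kb 1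
    hρ₁
  have hsymm : ∀ j i i' y, acoef j i i' y = acoef j i' i y := fun j i i' y =>
    congrArg (fun t : ℝ => 𝔄.cutoff j y * t) (gramInv_symm bE.toBasis g (𝔄.center j) y i i')
  have hlow : ∀ j, ∀ y ∈ Metric.thickening ρ₁ (𝔄.chart j '' tsupport (𝔄.ρ j)), ∀ ξ : Fin 4 → ℝ,
      l * ∑ i, ξ i ^ 2 ≤ ∑ i, ∑ i', acoef j i i' y * ξ i * ξ i' := fun j y hy ξ => by
    have hyK : y ∈ K' j := hthick j hy
    calc l * ∑ i, ξ i ^ 2 ≤ lam j * ∑ i, ξ i ^ 2 :=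
          mul_le_mul_of_nonneg_right (hlle j) (Finset.sum_nonneg fun i _ => sq_nonneg _)
      _ ≤ ∑ i, ∑ i', gramInv bE.toBasis g (𝔄.center j) y i i' * ξ i * ξ i' := hlam j y hyK ξ
      _ = ∑ i, ∑ i', acoef j i i' y * ξ i * ξ i' := by simp only [hacoef, hη1 j y hyK, one_mul]
  have hup : ∀ j, ∀ y ∈ Metric.thickening ρ₁ (𝔄.chart j '' tsupport (𝔄.ρ j)), ∀ ξ : Fin 4 → ℝ,
      ∑ i, ∑ i', acoef j i i' y * ξ i * ξ i' ≤ (Fintype.card (Fin 4) * Ka : ℝ) * ∑ i, ξ i ^ 2 :=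
    fun j y _ ξ => quadratic_le_card_mul_of_abs_le
      (fun i i' => by rw [← Real.norm_eq_abs]; exact ha0 j i i' y) ξ
  have haH : ∀ j i i', HolderOnWith Ka α (acoef j i i')
      (Metric.thickening ρ₁ (𝔄.chart j '' tsupport (𝔄.ρ j))) := fun j i i' =>
    ((hZ j i i').2.mono (hKa' j i i').2).holderOnWith _
  have hb0 : ∀ j l' y, y ∈ Metric.thickening ρ₁ (𝔄.chart j '' tsupport (𝔄.ρ j)) →
      ‖bcoef j l' y‖ ≤ Kb := fun j l' y _ =>
    ((hW j l').1 y).trans (NNReal.coe_le_coe.2 (hKb' j l').1)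
  have hbH : ∀ j l', HolderOnWith Kb α (bcoef j l')
      (Metric.thickening ρ₁ (𝔄.chart j '' tsupport (𝔄.ρ j))) := fun j l' =>
    ((hW j l').2.mono (hKb' j l').2).holderOnWith _
  have hc0 : ∀ j, ∀ y ∈ Metric.thickening ρ₁ (𝔄.chart j '' tsupport (𝔄.ρ j)),
      ‖ccoef j y‖ ≤ (1 : ℝ≥0) := fun j y _ => by simp [hccoef]
  have hcH : ∀ j, HolderOnWith 1 α (ccoef j)
      (Metric.thickening ρ₁ (𝔄.chart j '' tsupport (𝔄.ρ j))) := fun j y _ y' _ => by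
    simp only [hccoef, PseudoEMetricSpace.edist_self, zero_le]
  specialize hC acoef bcoef ccoef hsymm hlow hup (fun j i i' y _ => ha0 j i i' y) haH hb0 hbH
    hc0 hcH
  -- Step 5: conclusion
  refine ⟨C * (1 + Fintype.card ι), fun u => ?_⟩
  have hA : ∀ x, ‖u x‖ ≤ Fintype.card ι * ‖modelOperatorCLM 𝔄 g hα1.le u‖ := fun x =>
    u.norm_apply_le_card_mul_norm_modelOperator 𝔄 g hg hα1.le x
  have key : ‖u‖ ≤ C * (‖modelOperatorCLM 𝔄 g hα1.le u‖ +
      Fintype.card ι * ‖modelOperatorCLM 𝔄 g hα1.le u‖) := by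
    refine hC (modelOperatorCLM 𝔄 g hα1.le) ?_ u _ hA
    -- the chart representation of `Δ_g − 1`
    intro v j y
    have hv : (⇑(modelOperatorCLM 𝔄 g hα1.le v) : M → ℝ) = g.dalembertian ⇑v - ⇑v :=
      funext fun x => rfl
    have hL : dalembertianPieceCLM 𝔄 bE.toBasis g hα1.le j v y =
        𝔄.piece (fun _ : M => (1 : ℝ)) j y * (𝔄.cutoff j y *
          ((∑ a, ∑ b, gramInv bE.toBasis g (𝔄.center j) y a b *
              fderiv ℝ (fderiv ℝ (chartRestrictCLM 𝔄 hα1.le j (𝔄.cutoff j) (𝔄.contDiff_cutoff j)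
                (𝔄.hasCompactSupport_cutoff j) (𝔄.tsupport_cutoff_subset j) v :
                  EuclideanSpace ℝ (Fin 4) → ℝ)) y (bE.toBasis a) (bE.toBasis b)) +
            (∑ l', firstOrderCoeff bE.toBasis g (𝔄.center j) l' y *
              fderiv ℝ (chartRestrictCLM 𝔄 hα1.le j (𝔄.cutoff j) (𝔄.contDiff_cutoff j)
                (𝔄.hasCompactSupport_cutoff j) (𝔄.tsupport_cutoff_subset j) v :
                  EuclideanSpace ℝ (Fin 4) → ℝ) y (bE.toBasis l')) +
            0 * (chartRestrictCLM 𝔄 hα1.le j (𝔄.cutoff j) (𝔄.contDiff_cutoff j)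
                (𝔄.hasCompactSupport_cutoff j) (𝔄.tsupport_cutoff_subset j) v) y)) := by
      simp only [dalembertianPieceCLM, ContinuousLinearMap.coe_comp, Function.comp_apply,
        ContDiffHolderFunction.coeffCLM_apply, smul_eq_mul,
        ContDiffHolderFunction.localizedOperatorCLM_apply]
    rw [hv, 𝔄.piece_sub, Pi.sub_apply, ← dalembertianPieceCLM_apply_eq 𝔄 bE.toBasis g hα1.le j v y,
      hL, HolderChartData.piece_eq_piece_one_mul 𝔄 hα1.le v j y]
    simp only [OrthonormalBasis.coe_toBasis, iteratedFDeriv_two_apply, Matrix.cons_val_zero,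
      Matrix.cons_val_one, hacoef, hbcoef, hccoef]
    exact modelEstimate_rep_algebra _ _ _ _ _ _ _
  calc ‖u‖ ≤ C * (‖modelOperatorCLM 𝔄 g hα1.le u‖ +
      Fintype.card ι * ‖modelOperatorCLM 𝔄 g hα1.le u‖) := key
    _ = C * (1 + Fintype.card ι) * ‖modelOperatorCLM 𝔄 g hα1.le u‖ := by ring

end Summit.SmoothPoincare4.SmoothPoincare4.Theorems.MargerinRails

end
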